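import Literature.Barriers.CriticalPhenomena.RigorousRGSmallParameterLocDuality
import HarnessLib

/-!
# `RigorousRGSmallParameter` (Slade, Theorem 1.4.1): field locality `𝒩(X)` in the coefficient
# calculus, symmetry of pairings under permutation of tensor factors, and parity

Companion ("proof architecture") file of
`Literature/Barriers/CriticalPhenomena/RigorousRGSmallParameter.lean`, continuing the `Loc` files
(`…LocalMonomials`, `…LocDuality`). Three elementary facts about the pairing `⟨F, g⟩_φ` of
[BS-rg-norm]/[BS-rg-loc] that the localisation operator uses implicitly, for the concrete model
(fields `Λ_N → ℝⁿ` on the torus `TorusSite d M`):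

* **Field locality.** `𝒩(X)` "consists of those `F ∈ 𝒩` such that `F_z(φ) = 0` for all `φ`
  whenever any component of `z` lies outside of `X`" ([BS-rg-loc] §1.3). In the tree, `𝒩(X)` is
  `Polymer.DependsOn X F` (`F` depends on `φ|_X` only, `…Polymers`); we prove that this implies
  the printed property of the coefficients (`coeff_eq_zero_of_dependsOn`), that coefficients of
  `F ∈ 𝒩(X)` stay in `𝒩(X)`, and hence that `⟨F, g⟩_φ` only reads `g` on sequences inside `X`
  (`TphiPairing_congr_of_dependsOn`; the remark after (2.13) in [BS-rg-loc] §2.2).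
* **Symmetry.** `⟨F, g⟩_φ = ⟨F, Sg⟩_φ` ([BS-rg-loc] (2.1)) in the form used for the binomial and
  dual test functions: pairings with an ordered product `β_1 ⊗ ⋯ ⊗ β_p` do not depend on the order
  of the factors (`TphiPairing_tensorTF_perm`, from `Tphi.coeff_perm`).
* **Parity.** For `F` even in the field (`F(-φ) = F(φ)`, as `O(n)`-invariant functionals are),
  `F_z(-φ) = (-1)^{|z|}F_z(φ)`, so zero-field pairings with product test functions of odd rank
  vanish (`TphiPairing_tensorTF_eq_zero_of_even`) — Slade's "symmetry considerations preclude the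
  occurrence of monomials with an odd number of fields" (after Definition 3.4.2).

Sources: D. C. Brydges, G. Slade, *A renormalisation group method. II.*, J. Stat. Phys. 159 (2015)
461–491, arXiv:1403.7253 (§1.3 definition of `𝒩(X)`, §2.1 (2.1), §2.2 after (2.13));
G. Slade, arXiv:1611.06169, Definition 3.4.2 and the sentence following it.

## What this file provides (definitions with proved properties; no named fact)

* `maskCLM` (restriction to `X` as a continuous linear map), `maskCLM_apply_of_mem`,
  `eq_comp_mask_of_dependsOn`, `dirDeriv_eq_of_dependsOn`, `dependsOn_dirDeriv`,
  `dirDeriv_basisDir_eq_zero_of_dependsOn`, **`dependsOn_coeff`**, **`coeff_eq_zero_of_dependsOn`**,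
  **`TphiPairing_congr_of_dependsOn`**.
* `sumSeq_eq_sum_fn` (`Σ_{|z|=r}` as a sum over `r`-tuples), `tensorTF_ofFn`,
  **`TphiPairing_tensorTF_perm`** (permutation `σ` of the factors), **`TphiPairing_tensorTF_cons`**
  (peeling: `⟨F, β ⊗ L⟩_φ = (|L|+1)⁻¹Σ_y β(y)⟨∂_{e_y}F, ⊗L⟩_φ`), `TphiPairing_tensorTF_eq_zero_of_lt`
  (truncation), **`TphiPairing_tensorTF_of_perm`** (`List.Perm` of the factors),
  **`TphiPairing_tensorTF_cons_expand`** (linearity in the first factor for `F ∈ 𝒩(U)` with an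
  identity of one-point functions valid on `U` only).
* **`TphiPairing_tensorTF_eq_zero_of_even`**.

## References

* [BrydgesSlade2015RGII] D. C. Brydges, G. Slade, *A renormalisation group method. II.
  Approximation by local polynomials*, J. Stat. Phys. 159 (2015) 461–491, arXiv:1403.7253 —
  §1.3, §2.1–2.2.
* [Slade2017] G. Slade, *Critical exponents for long-range O(n) models below the upper critical
  dimension*, Commun. Math. Phys. 358 (2018) 343–436, arXiv:1611.06169 — Definition 3.4.2.
-/

noncomputable section

namespace Literature.Barriers.CriticalPhenomena

namespace LongRangePhi4

namespace Loc

open Finset Tphi RGNorm LocalPoly Polymer Literature.Probability.LatticeModels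
open scoped ContDiff

variable {d M n : ℕ} [NeZero M]

/-! ### Field locality: coefficients of `F ∈ 𝒩(X)` vanish off `X` -/

/-- Restriction of the field to `X` (extended by zero): a continuous linear map. [folklore] -/
def maskCLM (X : Finset (TorusSite d M)) : (TorusSite d M → Fin n → ℝ) →L[ℝ] (TorusSite d M → Fin n → ℝ) :=
  { toFun := fun φ x i => if x ∈ X then φ x i else 0
    map_add' := fun φ ψ => by funext x i; by_cases h : x ∈ X <;> simp [h]
    map_smul' := fun c φ => by funext x i; by_cases h : x ∈ X <;> simp [h]
    cont := by
      apply continuous_pi; intro x; apply continuous_pi; intro i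
      by_cases h : x ∈ X
      · simp only [h, if_true]; exact (continuous_apply i).comp (continuous_apply x)
      · simp only [h, if_false]; exact continuous_const }

omit [NeZero M] in
/-- The mask agrees with the field on `X`. [folklore] -/
theorem maskCLM_apply_of_mem (X : Finset (TorusSite d M)) (φ : TorusSite d M → Fin n → ℝ) {x : TorusSite d M}
    (hx : x ∈ X) : maskCLM X φ x = φ x := by
  funext i; simp [maskCLM, hx]

omit [NeZero M] in
/-- `F ∈ 𝒩(X)` factors through the mask: `F = F ∘ P_X`. [folklore] -/
theorem eq_comp_mask_of_dependsOn {X : Finset (TorusSite d M)} {F : (TorusSite d M → Fin n → ℝ) → ℝ}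
    (hF : DependsOn X F) : F = fun φ => F (maskCLM X φ) :=
  funext fun φ => hF φ _ fun _ hx => (maskCLM_apply_of_mem X φ hx).symm

/-- **Directional derivatives of `F ∈ 𝒩(X)`** only see the direction on `X`, and stay in `𝒩(X)`:
`∂_v F(φ) = DF(P_Xφ)(P_X v)`. [folklore] -/
theorem dirDeriv_eq_of_dependsOn {X : Finset (TorusSite d M)} {F : (TorusSite d M → Fin n → ℝ) → ℝ}
    (hF : DependsOn X F) (hd : Differentiable ℝ F) (v : TorusSite d M → Fin n → ℝ) :
    dirDeriv v F = fun φ => fderiv ℝ F (maskCLM X φ) (maskCLM X v) := by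
  funext φ
  unfold dirDeriv
  have h := eq_comp_mask_of_dependsOn hF
  have hcomp : HasFDerivAt (fun ψ => F (maskCLM X ψ)) ((fderiv ℝ F (maskCLM X φ)).comp (maskCLM X)) φ :=
    (hd (maskCLM X φ)).hasFDerivAt.comp φ (maskCLM X).hasFDerivAt
  conv_lhs => rw [h]
  rw [hcomp.fderiv]
  rfl

/-- `∂_v F ∈ 𝒩(X)` for `F ∈ 𝒩(X)`. [folklore] -/
theorem dependsOn_dirDeriv {X : Finset (TorusSite d M)} {F : (TorusSite d M → Fin n → ℝ) → ℝ}
    (hF : DependsOn X F) (hd : Differentiable ℝ F) (v : TorusSite d M → Fin n → ℝ) :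
    DependsOn X (Tphi.dirDeriv v F) := by
  rw [dirDeriv_eq_of_dependsOn hF hd v]
  intro φ ψ hφψ
  have : maskCLM X φ = maskCLM X ψ := by
    funext x i
    by_cases hx : x ∈ X
    · simp [maskCLM, hx, hφψ x hx]
    · simp [maskCLM, hx]
  simp only [this]

/-- `∂_{e_{(y,i)}} F = 0` for `F ∈ 𝒩(X)` and `y ∉ X`. [folklore] -/
theorem dirDeriv_basisDir_eq_zero_of_dependsOn {X : Finset (TorusSite d M)} {F : (TorusSite d M → Fin n → ℝ) → ℝ}
    (hF : DependsOn X F) (hd : Differentiable ℝ F) {y : TorusSite d M × Fin n} (hy : y.1 ∉ X) :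
    Tphi.dirDeriv (basisDir d M n y) F = fun _ => 0 := by
  rw [dirDeriv_eq_of_dependsOn hF hd]
  funext φ
  have h0 : maskCLM X (basisDir d M n y) = 0 := by
    funext x i
    by_cases hx : x ∈ X
    · have : ¬ (x = y.1 ∧ i = y.2) := fun h => hy (h.1 ▸ hx)
      show (if x ∈ X then basisDir d M n y x i else 0) = 0
      rw [if_pos hx, basisDir_apply, if_neg this]
    · show (if x ∈ X then basisDir d M n y x i else 0) = 0
      rw [if_neg hx]
  rw [h0, map_zero]

/-- **The coefficients of `F ∈ 𝒩(X)` stay in `𝒩(X)`.** [folklore] -/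
theorem dependsOn_coeff {X : Finset (TorusSite d M)} {F : (TorusSite d M → Fin n → ℝ) → ℝ}
    (hF : DependsOn X F) (hs : ContDiff ℝ ∞ F) : ∀ z : List (TorusSite d M × Fin n),
    DependsOn X (coeff (basisDir d M n) z F)
  | [] => hF
  | a :: z => by
      rw [coeff_cons]
      exact dependsOn_dirDeriv (dependsOn_coeff hF hs z) (differentiable_of_contDiff (contDiff_coeff _ hs z)) _

/-- **The coefficients `F_z` of `F ∈ 𝒩(X)` vanish whenever a component of `z` lies outside `X`**
(the definition of `𝒩(X)` in [BS-rg-norm]/[BS-rg-loc]: "`F_z(φ) = 0` for all `φ` whenever any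
component of `z` lies outside of `X`"). [cite: BrydgesSlade2015RGII, §1.3 (definition of 𝒩(X) recalled before Proposition 1.3.1)] -/
theorem coeff_eq_zero_of_dependsOn {X : Finset (TorusSite d M)} {F : (TorusSite d M → Fin n → ℝ) → ℝ}
    (hF : DependsOn X F) (hs : ContDiff ℝ ∞ F) :
    ∀ {z : List (TorusSite d M × Fin n)}, (∃ y ∈ z, y.1 ∉ X) → coeff (basisDir d M n) z F = fun _ => 0
  | [], h => by simp at h
  | a :: z, h => by
      rw [coeff_cons]
      by_cases ha : a.1 ∈ X
      · have h' : ∃ y ∈ z, y.1 ∉ X := by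
          obtain ⟨y, hy, hyX⟩ := h
          rw [List.mem_cons] at hy
          rcases hy with rfl | hy
          · exact absurd ha hyX
          · exact ⟨y, hy, hyX⟩
        rw [coeff_eq_zero_of_dependsOn hF hs h']
        funext φ; simp [Tphi.dirDeriv]
      · exact dirDeriv_basisDir_eq_zero_of_dependsOn (dependsOn_coeff hF hs z)
          (differentiable_of_contDiff (contDiff_coeff _ hs z)) ha

/-- **Pairings with `F ∈ 𝒩(X)` only read the test function on sequences inside `X`**
("if `F ∈ 𝒩(X)` then `⟨F,g⟩_φ = ⟨F, g - f⟩_φ`" for `f` vanishing on `X`-sequences).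
[cite: BrydgesSlade2015RGII, §2.2 (the sentence after display (2.13) defining ‖g‖_{Φ(X)})] -/
theorem TphiPairing_congr_of_dependsOn {X : Finset (TorusSite d M)} {F : (TorusSite d M → Fin n → ℝ) → ℝ}
    (hF : DependsOn X F) (hs : ContDiff ℝ ∞ F) (pN : ℕ) (φ : TorusSite d M → Fin n → ℝ)
    {g g' : List (TorusSite d M × Fin n) → ℝ} (h : ∀ z : List (TorusSite d M × Fin n), (∀ y ∈ z, y.1 ∈ X) → g z = g' z) :
    TphiPairing pN (basisDir d M n) F φ g = TphiPairing pN (basisDir d M n) F φ g' := by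
  unfold TphiPairing pairing
  refine Finset.sum_congr rfl fun r _ => ?_
  congr 1
  refine sumSeq_congr r fun z _ => ?_
  by_cases hz : ∀ y ∈ z, y.1 ∈ X
  · rw [h z hz]
  · simp only [not_forall] at hz
    obtain ⟨y, hy, hyX⟩ := hz
    simp only [coeffFamily]
    rw [coeff_eq_zero_of_dependsOn hF hs ⟨y, hy, hyX⟩]
    simp

/-! ### Symmetry of pairings with product test functions under permutation of the factors -/

omit [NeZero M] in
/-- `Σ_{|z| = r} f(z)` as a sum over `r`-tuples. [folklore] -/
theorem sumSeq_eq_sum_fn {Ξ : Type*} [Fintype Ξ] {N : Type*} [AddCommMonoid N] :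
    ∀ (r : ℕ) (f : List Ξ → N), sumSeq r f = ∑ v : Fin r → Ξ, f (List.ofFn v)
  | 0, f => by simp
  | r + 1, f => by
      rw [sumSeq_succ]
      simp only [sumSeq_eq_sum_fn r]
      rw [← Fintype.sum_prod_type']
      refine Fintype.sum_equiv (Fin.consEquiv fun _ => Ξ) _ _ fun p => ?_
      rw [List.ofFn_succ]
      rfl

omit [NeZero M] in
/-- The product test function on a tuple: `(⊗βs)_{(v_1,…,v_p)} = ∏_k β_k(v_k)`. [folklore] -/
theorem tensorTF_ofFn : ∀ (p : ℕ) (βs : List (TorusSite d M × Fin n → ℝ)) (v : Fin p → TorusSite d M × Fin n),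
    βs.length = p → tensorTF βs (List.ofFn v) = ∏ k : Fin p, βs.getD k 0 (v k)
  | 0, [], v, _ => by simp
  | 0, _ :: _, _, h => by simp at h
  | _ + 1, [], _, h => by simp at h
  | p + 1, β :: βs, v, h => by
      rw [List.ofFn_succ, tensorTF_cons_cons, tensorTF_ofFn p βs _ (by simpa using h), Fin.prod_univ_succ]
      simp

/-- **Pairings with `F ∈ 𝒩` do not see the order of the factors of a product test function**:
`⟨F, β_{σ1} ⊗ ⋯ ⊗ β_{σp}⟩_φ = ⟨F, β_1 ⊗ ⋯ ⊗ β_p⟩_φ` — the instance of `⟨F, Sg⟩_φ = ⟨F, g⟩_φ`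
([BS-rg-loc] (2.1), from the symmetry of the coefficients `F_z`) used for the binomial and dual
test functions. [cite: BrydgesSlade2015RGII, §2.1 (display (2.1): ⟨F,g⟩_φ = ⟨F,Sg⟩_φ)] -/
theorem TphiPairing_tensorTF_perm (pN : ℕ) {F : (TorusSite d M → Fin n → ℝ) → ℝ} (hF : ContDiff ℝ ∞ F)
    (φ : TorusSite d M → Fin n → ℝ) (βs : List (TorusSite d M × Fin n → ℝ)) (σ : Equiv.Perm (Fin βs.length)) :
    TphiPairing pN (basisDir d M n) F φ (tensorTF (List.ofFn fun k => βs.get (σ k))) =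
      TphiPairing pN (basisDir d M n) F φ (tensorTF βs) := by
  unfold TphiPairing pairing
  refine Finset.sum_congr rfl fun r _ => ?_
  congr 1
  by_cases hr : r = βs.length
  · subst hr
    rw [sumSeq_eq_sum_fn, sumSeq_eq_sum_fn]
    simp only [coeffFamily]
    have hL : ∀ v : Fin βs.length → TorusSite d M × Fin n,
        tensorTF (List.ofFn fun k => βs.get (σ k)) (List.ofFn v) = ∏ k : Fin βs.length, βs.get (σ k) (v k) := by
      intro v
      rw [tensorTF_ofFn βs.length _ v (List.length_ofFn ..)]
      refine Finset.prod_congr rfl fun k _ => ?_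
      rw [List.getD_eq_getElem _ _ (by simp), List.getElem_ofFn]
    have hR : ∀ v : Fin βs.length → TorusSite d M × Fin n,
        tensorTF βs (List.ofFn v) = ∏ k : Fin βs.length, βs.get k (v k) := by
      intro v
      rw [tensorTF_ofFn βs.length βs v rfl]
      refine Finset.prod_congr rfl fun k _ => ?_
      rw [List.getD_eq_getElem _ _ k.2]
      rfl
    simp only [hL, hR]
    -- reindex the product by `σ` and the sum by `u ↦ u ∘ σ`
    have hprod : ∀ v : Fin βs.length → TorusSite d M × Fin n,
        ∏ k : Fin βs.length, βs.get (σ k) (v k) = ∏ j : Fin βs.length, βs.get j (v (σ.symm j)) :=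
      fun v => Fintype.prod_equiv σ _ _ fun k => by simp
    simp only [hprod]
    let e : (Fin βs.length → TorusSite d M × Fin n) ≃ (Fin βs.length → TorusSite d M × Fin n) :=
      σ.symm.arrowCongr (Equiv.refl _)
    rw [← Equiv.sum_comp e]
    refine Finset.sum_congr rfl fun u _ => ?_
    have he : e u = u ∘ σ := by
      funext k; simp [e, Equiv.arrowCongr_apply]
    rw [he, coeff_perm (basisDir d M n) (Equiv.Perm.ofFn_comp_perm σ u) hF]
    congr 1
    exact Finset.prod_congr rfl fun j _ => by simp
  · refine sumSeq_congr r fun z hz => ?_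
    rw [tensorTF_eq_zero_of_length _ z (by simp; omega), tensorTF_eq_zero_of_length _ z (by omega)]

/-- **Peeling off the first factor**: `⟨F, β ⊗ L⟩_φ = (|L|+1)⁻¹ Σ_y β(y) ⟨∂_{e_y}F, ⊗L⟩_φ`
(`F_{y·z} = (∂_{e_y}F)_z`); in particular the pairing is linear in each tensor factor. [folklore] -/
theorem TphiPairing_tensorTF_cons (pN : ℕ) {F : (TorusSite d M → Fin n → ℝ) → ℝ} (hF : ContDiff ℝ ∞ F)
    (φ : TorusSite d M → Fin n → ℝ) (β : TorusSite d M × Fin n → ℝ) (L : List (TorusSite d M × Fin n → ℝ))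
    (hp : L.length + 1 ≤ pN) :
    TphiPairing pN (basisDir d M n) F φ (tensorTF (β :: L)) =
      ((L.length + 1 : ℕ) : ℝ)⁻¹ * ∑ y, β y * TphiPairing pN (basisDir d M n) (Tphi.dirDeriv (basisDir d M n y) F) φ (tensorTF L) := by
  unfold TphiPairing pairing
  rw [Finset.sum_eq_single (L.length + 1)]
  · have hin : ∀ y, ∑ r ∈ range (pN + 1), ((r.factorial : ℕ) : ℝ)⁻¹ *
        sumSeq r (fun z => coeffFamily (basisDir d M n) (Tphi.dirDeriv (basisDir d M n y) F) φ z * tensorTF L z) =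
        ((L.length.factorial : ℕ) : ℝ)⁻¹ *
          sumSeq L.length (fun z => coeffFamily (basisDir d M n) (Tphi.dirDeriv (basisDir d M n y) F) φ z * tensorTF L z) := by
      intro y
      rw [Finset.sum_eq_single L.length]
      · intro r _ hr
        rw [sumSeq_congr r (g := fun _ => 0), sumSeq_zero_fun, mul_zero]
        intro z hz
        rw [tensorTF_eq_zero_of_length _ z (by omega), mul_zero]
      · intro h; exact absurd (Finset.mem_range.2 (by omega)) h
    simp only [hin]
    rw [sumSeq_succ, Finset.mul_sum, Finset.mul_sum]
    refine Finset.sum_congr rfl fun y _ => ?_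
    rw [← mul_assoc, ← mul_assoc, ← sumSeq_mul_left, ← sumSeq_mul_left]
    have hfac : ((((L.length + 1).factorial : ℕ) : ℝ))⁻¹ =
        ((L.length + 1 : ℕ) : ℝ)⁻¹ * (((L.length.factorial : ℕ) : ℝ))⁻¹ := by
      rw [Nat.factorial_succ]; push_cast; rw [mul_inv]
    refine sumSeq_congr L.length fun z _ => ?_
    simp only [coeffFamily, tensorTF_cons_cons]
    rw [← coeff_dirDeriv (basisDir d M n) y z hF, hfac]
    ring
  · intro r _ hr
    rw [sumSeq_congr r (g := fun _ => 0), sumSeq_zero_fun, mul_zero]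
    intro z hz
    rw [tensorTF_eq_zero_of_length _ z (by simp; omega), mul_zero]
  · intro h; exact absurd (Finset.mem_range.2 (by omega)) h

/-- A pairing with a product test function of rank `> p_𝒩` vanishes (truncation of the pairing). [folklore] -/
theorem TphiPairing_tensorTF_eq_zero_of_lt (pN : ℕ) (F : (TorusSite d M → Fin n → ℝ) → ℝ)
    (φ : TorusSite d M → Fin n → ℝ) (L : List (TorusSite d M × Fin n → ℝ)) (hp : pN < L.length) :
    TphiPairing pN (basisDir d M n) F φ (tensorTF L) = 0 := by
  unfold TphiPairing pairing
  refine Finset.sum_eq_zero fun r hr => ?_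
  rw [Finset.mem_range] at hr
  rw [sumSeq_congr r (g := fun _ => 0), sumSeq_zero_fun, mul_zero]
  intro z hz
  rw [tensorTF_eq_zero_of_length _ z (by omega), mul_zero]

/-- **`⟨F, ⊗L⟩_φ = ⟨F, ⊗L'⟩_φ` for rearrangements `L ~ L'` of the factors** (the symmetry
`⟨F, Sg⟩ = ⟨F, g⟩`, [BS-rg-loc] (2.1), for product test functions; from the commutation of
directional derivatives). [cite: BrydgesSlade2015RGII, §2.1 (display (2.1))] -/
theorem TphiPairing_tensorTF_of_perm (pN : ℕ) {L L' : List (TorusSite d M × Fin n → ℝ)} (h : L.Perm L') :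
    ∀ {F : (TorusSite d M → Fin n → ℝ) → ℝ}, ContDiff ℝ ∞ F → ∀ φ : TorusSite d M → Fin n → ℝ,
    TphiPairing pN (basisDir d M n) F φ (tensorTF L) = TphiPairing pN (basisDir d M n) F φ (tensorTF L') := by
  induction h with
  | nil => intro F _ φ; rfl
  | @cons β l l' hl ih =>
      intro F hF φ
      by_cases hp : l.length + 1 ≤ pN
      · rw [TphiPairing_tensorTF_cons pN hF φ β l hp, TphiPairing_tensorTF_cons pN hF φ β l' (hl.length_eq ▸ hp),
          hl.length_eq]
        congr 1
        refine Finset.sum_congr rfl fun y _ => ?_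
        rw [ih (contDiff_dirDeriv hF _) φ]
      · rw [TphiPairing_tensorTF_eq_zero_of_lt pN F φ _ (by simp; omega),
          TphiPairing_tensorTF_eq_zero_of_lt pN F φ _ (by simp [← hl.length_eq]; omega)]
  | swap β γ l =>
      intro F hF φ
      by_cases hp : l.length + 2 ≤ pN
      · rw [TphiPairing_tensorTF_cons pN hF φ γ (β :: l) (by simp; omega),
          TphiPairing_tensorTF_cons pN hF φ β (γ :: l) (by simp; omega)]
        simp only [List.length_cons]
        congr 1
        simp only [TphiPairing_tensorTF_cons pN (contDiff_dirDeriv hF _) φ _ l (by omega), Finset.mul_sum]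
        rw [Finset.sum_comm]
        refine Finset.sum_congr rfl fun y _ => Finset.sum_congr rfl fun y' _ => ?_
        rw [dirDeriv_comm hF]
        ring
      · rw [TphiPairing_tensorTF_eq_zero_of_lt pN F φ _ (by simp; omega),
          TphiPairing_tensorTF_eq_zero_of_lt pN F φ _ (by simp; omega)]
  | trans _ _ ih₁ ih₂ => intro F hF φ; rw [ih₁ hF φ, ih₂ hF φ]

/-- **Linearity in the first tensor factor, for `F ∈ 𝒩(U)`, with an identity of one-point
functions valid only on `U`**: if `β = Σ_s c_s γ_s` on `U × {1,…,n}` then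
`⟨F, β ⊗ L⟩_φ = Σ_s c_s ⟨F, γ_s ⊗ L⟩_φ`. [folklore] -/
theorem TphiPairing_tensorTF_cons_expand {U : Finset (TorusSite d M)} {F : (TorusSite d M → Fin n → ℝ) → ℝ}
    (hFU : DependsOn U F) (hF : ContDiff ℝ ∞ F) (pN : ℕ) (φ : TorusSite d M → Fin n → ℝ)
    {S : Type*} (s₀ : Finset S) (c : S → ℝ) (γ : S → TorusSite d M × Fin n → ℝ)
    (β : TorusSite d M × Fin n → ℝ) (hβ : ∀ y : TorusSite d M × Fin n, y.1 ∈ U → β y = ∑ s ∈ s₀, c s * γ s y)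
    (L : List (TorusSite d M × Fin n → ℝ)) :
    TphiPairing pN (basisDir d M n) F φ (tensorTF (β :: L)) =
      ∑ s ∈ s₀, c s * TphiPairing pN (basisDir d M n) F φ (tensorTF (γ s :: L)) := by
  rw [TphiPairing_congr_of_dependsOn hFU hF pN φ (g' := fun z => ∑ s ∈ s₀, c s * tensorTF (γ s :: L) z)]
  · unfold TphiPairing
    rw [pairing_sum_right]
    exact Finset.sum_congr rfl fun s _ => pairing_smul_right pN _ _ _
  · intro z hz
    cases z with
    | nil => simp [tensorTF]
    | cons y z =>
        simp only [tensorTF_cons_cons]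
        rw [hβ y (hz y List.mem_cons_self), Finset.sum_mul]
        exact Finset.sum_congr rfl fun s _ => by ring

/-! ### Parity: even elements of `𝒩` pair trivially with odd-rank product test functions -/

/-- **For `F` even in the field (`F(-φ) = F(φ)`, e.g. `O(n)`-invariant), the zero-field pairing
with a product test function of odd rank vanishes** ("symmetry considerations preclude the
occurrence of monomials with an odd number of fields", Slade, after Definition 3.4.2).
[cite: Slade2017, §3.3 (sentence after Definition 3.4.2)] -/
theorem TphiPairing_tensorTF_eq_zero_of_even (pN : ℕ) {F : (TorusSite d M → Fin n → ℝ) → ℝ} (hF : ContDiff ℝ ∞ F)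
    (heven : ∀ φ, F (-φ) = F φ) (βs : List (TorusSite d M × Fin n → ℝ)) (hodd : Odd βs.length) :
    TphiPairing pN (basisDir d M n) F 0 (tensorTF βs) = 0 := by
  -- the coefficients of odd length of an even `F` vanish at `φ = 0`
  have hneg : ∀ (z : List (TorusSite d M × Fin n)) (φ : TorusSite d M → Fin n → ℝ),
      coeff (basisDir d M n) z F (-φ) = (-1) ^ z.length * coeff (basisDir d M n) z F φ := by
    intro z
    induction z with
    | nil => intro φ; simpa using heven φ
    | cons a z ih =>
        intro φ
        rw [coeff_cons, List.length_cons, pow_succ]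
        have hd : Differentiable ℝ (coeff (basisDir d M n) z F) := differentiable_of_contDiff (contDiff_coeff _ hF z)
        -- differentiate the identity `F_z(-ψ) = (-1)^{|z|} F_z(ψ)` along `e_a`
        have hfun : (fun ψ => coeff (basisDir d M n) z F (-ψ)) = fun ψ => (-1) ^ z.length * coeff (basisDir d M n) z F ψ :=
          funext ih
        have h1 : HasFDerivAt (fun ψ => coeff (basisDir d M n) z F (-ψ))
            ((fderiv ℝ (coeff (basisDir d M n) z F) (-φ)).comp (-(ContinuousLinearMap.id ℝ _))) φ :=
          (hd (-φ)).hasFDerivAt.comp φ ((hasFDerivAt_id φ).neg)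
        have h2 : HasFDerivAt (fun ψ => (-1 : ℝ) ^ z.length * coeff (basisDir d M n) z F ψ)
            (((-1 : ℝ) ^ z.length) • fderiv ℝ (coeff (basisDir d M n) z F) φ) φ :=
          (hd φ).hasFDerivAt.const_mul _
        rw [hfun] at h1
        have h3 := h1.unique h2
        have h4 := DFunLike.congr_fun h3 (basisDir d M n a)
        simp only [ContinuousLinearMap.coe_comp, Function.comp_apply, FunLike.coe_neg,
          Pi.neg_apply, ContinuousLinearMap.coe_id', id_eq, map_neg, FunLike.coe_smul,
          Pi.smul_apply, smul_eq_mul] at h4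
        simp only [Tphi.dirDeriv]
        linarith
  have hzero : ∀ z : List (TorusSite d M × Fin n), z.length = βs.length → coeff (basisDir d M n) z F 0 = 0 := by
    intro z hz
    have h := hneg z 0
    rw [neg_zero, hz, hodd.neg_one_pow] at h
    linarith
  unfold TphiPairing pairing
  refine Finset.sum_eq_zero fun r _ => ?_
  rw [sumSeq_congr r (g := fun _ => 0), sumSeq_zero_fun, mul_zero]
  intro z hz
  by_cases hr : r = βs.length
  · simp only [coeffFamily]; rw [hzero z (hz.trans hr), zero_mul]
  · rw [tensorTF_eq_zero_of_length _ z (by omega), mul_zero]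

end Loc

end LongRangePhi4

end Literature.Barriers.CriticalPhenomena

end
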